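import Literature.MathematicalPhysics.QuantumFieldTheory.Balaban1983to89.B5Block118
import Summits.QuantumFields.BalabanUV.T4Continuum.Support.NE3BlockLineAverage
import Summits.QuantumFields.BalabanUV.T4Continuum.Support.AveragingDeficitTorusChart
import HarnessLib

/-!
# NE7StraightSliceB5Chart — row NE7 (node U5), the (A)-bill's XL(c) docking, file D5 (i)+(ii) of `t4/b2b-balaban-t4-ne7-p2/g84/XLC-DOCKING-MEMO.md` §7:
# FIRST KERNEL CONTACT BETWEEN THE T4 TREE AND lit-balaban's B5 — BAŁABAN's PRINTED BLOCK AVERAGE `Q_k` ((1.18), `B5Block118.QvOp`) READ THROUGH THE TORUS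
# CHART IS `η ×` THE T4 STRAIGHT `L^j`-BLOCK LINE MEAN `(Qcoarse L)^[j]`; so the straight slice of (139)∕(141)∕(142) IS `ker Q_k` VERBATIM

Lineage `b2b-balaban-t4-ne7-p2` (CRUX PROVER NE7 #2, co-owner of row NE7), generation 84.  Over lit-balaban's `B5Block118` (`QvOp`, `QvOp_mulVec`, `bpt = up + iota`,
`lineSum`, `tstep`, `upHom_intCast`; [Balaban1984PropagatorsI] (1.18) p. 20, kernel-typed by the lit-balaban cell), the NE3 swarm's tiling
`NE3BlockLineAverage.iterate_Qcoarse_apply` ∕ `sum_univ_boxVec`, and `AveragingDeficitTorusChart.periodic_smul_vec`.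
WHY.  After (137)–(142) the (A)-bill's XL(c) driver is ONE letter about ONE imaginary scalar field on the STRAIGHT slice `(Qcoarse L)^[j] ξ = 0` of the unit torus of side
`L^j·N`; its supplier is lit-balaban's Proposition 1.2 for `G = Δ_a⁻¹` on the torus `B5Prop11Plancherel.Tor (fine n M)` (`n = L^j` fine steps per unit, coarse sides `M`).
The docking needs a CHART between the two typings and the identification of the constraints.  THIS FILE: the chart `liftT : Tor N → Site d` (`ZMod.val` coordinatewise),
the transfer `toB5 ξ (x̄, μ) = (ξ (liftT x̄) μ)₀₀` of a rank-one periodic T4 field to a B5 vector field, the reading lemmas (a `P`-periodic function reads sums through the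
chart: `read_liftT_add`; `liftT (tstep μ t) = t•e_μ`, `liftT (iota j) = boxVec n j`, `liftT (up y) = n • liftT y`), and **`QvOp_mulVec_toB5`**:
`(QvOp n M *ᵥ toB5 ξ) (y, μ) = n⁻¹ · ((Qcoarse L)^[j] ξ (liftT y) μ)₀₀` for `n = L^j`, `M ≡ N`, `ξ` `(L^j·N)`-periodic — hence **`QvOp_toB5_eq_zero_iff`**: the T4 straight
constraint holds iff Bałaban's `Q_k` annihilates the transferred field.  (B5's extra factor `η = n⁻¹` is the bond-length normalisation `η^{d+1}` of (1.18) against T4's `(L^j)^{−d}`.)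
HONEST FRAMING (page 1): [folklore] index bookkeeping (`ZMod.val` arithmetic); NO estimate; nothing of Bałaban's asserted beyond the lit-balaban cell's typed definition (1.18);
NOT (APE), NOT ONE-STEP, NOT NE7; spine 0∕9; finite T⁴ rung (B)+1 — NOT infinite volume, NOT mass gap, NOT Clay.  Continuum YM on T⁴ ⇐ BetaPertH ∧ nine spine estimates
(0/9 proved); BetaPertH ⇐ (D1) ∧ (D4) ∧ CAP+tail; G-an2-4 gates asym, D1 and NE2/3/4.
-/

set_option autoImplicit false

open scoped BigOperators Matrix Matrix.Norms.L2Operator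
open Finset

namespace Summit.QuantumFields.BalabanUV.T4Continuum.NE7StraightSliceB5Chart

open Literature.MathematicalPhysics.QuantumFieldTheory.Balaban1983to89
open B7Prop1Explicit
open B5Prop11Plancherel (Tor fine)
open B5Block118 (QvOp QvOp_mulVec lineSum bpt up iota tstep upHom upHom_intCast)
open T4AveragingDeficitWallBoundary (periodBox)
open AveragingDeficitPeriodicCounting (IsPeriodicDir)
open AveragingDeficitTorusChart (periodic_smul_vec)
open NE3TangentFlatStructure (Qcoarse)
open NE3BlockLineAverage (iterate_Qcoarse_apply sum_univ_boxVec)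

noncomputable section

variable {d : ℕ}

/-! ## §1 The chart `Tor N → ℤ^d` by `ZMod.val`, and how periodic functions read through it -/

/-- **THE CHART**: a point of the product torus `Π_ν ℤ∕N_ν` read in `ℤ^d` by its canonical representatives `0 ≤ x_ν < N_ν`. [folklore] -/
def liftT {N : Fin d → ℕ} (x : Tor N) : Site d := fun ν => ((x ν).val : ℤ)

/-- unfolding. [folklore] -/
theorem liftT_apply {N : Fin d → ℕ} (x : Tor N) (ν : Fin d) : liftT x ν = ((x ν).val : ℤ) := rfl

/-- **Sums read through the chart up to the period lattice**: `liftT (x + y) = liftT x + liftT y + P•k` on the isotropic torus `(ℤ∕P)^d`. [folklore] -/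
theorem liftT_add (P : ℕ) [NeZero P] (x y : Tor (fun _ : Fin d => P)) :
    ∃ k : Site d, liftT (x + y) = liftT x + liftT y + (P : ℤ) • k := by
  refine ⟨fun ν => -((((x ν).val + (y ν).val : ℕ) : ℤ) / (P : ℤ)), funext fun ν => ?_⟩
  simp only [liftT, Pi.add_apply, Pi.smul_apply, smul_eq_mul]
  rw [ZMod.val_add, Int.natCast_mod, Int.emod_def]
  push_cast
  ring

/-- **A `P`-periodic function reads a torus sum as the lattice sum.** [folklore] -/
theorem read_liftT_add {α : Type*} (P : ℕ) [NeZero P] {f : Site d → α} (hf : ∀ (x : Site d) (κ : Fin d), f (x + (P : ℤ) • e κ) = f x)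
    (x y : Tor (fun _ : Fin d => P)) : f (liftT (x + y)) = f (liftT x + liftT y) := by
  obtain ⟨k, hk⟩ := liftT_add P x y
  rw [hk]
  exact periodic_smul_vec hf _ k

/-- A lattice step reads as a lattice step: `liftT (tstep μ t) = t•e_μ` for `t < P`. [folklore] -/
theorem liftT_tstep (P : ℕ) [NeZero P] (μ : Fin d) {t : ℕ} (ht : t < P) :
    liftT (tstep (fun _ : Fin d => P) μ t) = (t : ℤ) • e μ := by
  funext ν
  simp only [liftT, tstep, Pi.smul_apply, smul_eq_mul, e]
  by_cases h : ν = μ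
  · subst h; simp [ZMod.val_cast_of_lt ht]
  · rw [if_neg h, ZMod.val_zero, Pi.single_eq_of_ne h]; simp

/-- A block offset reads as the tree's `boxVec`: `liftT (iota n M j) = boxVec n j` (`n ≤ n·M_ν`). [folklore] -/
theorem liftT_iota (n Mc : ℕ) [NeZero n] [NeZero Mc] (j : Fin d → Fin n) :
    liftT (iota n (fun _ : Fin d => Mc) j) = boxVec n j := by
  funext ν
  simp only [liftT, iota, boxVec]
  have hlt : (j ν : ℕ) < fine n (fun _ : Fin d => Mc) ν := by
    show (j ν : ℕ) < n * Mc
    exact (j ν).isLt.trans_le (Nat.le_mul_of_pos_right n (Nat.pos_of_ne_zero (NeZero.ne Mc)))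
  rw [ZMod.val_cast_of_lt hlt]

/-- A coarse point reads as `n` times its coarse representative: `liftT (up n M y) = n • liftT y` (no wrap: `n·y_ν < n·M_ν`). [folklore] -/
theorem liftT_up (n Mc : ℕ) [NeZero n] [NeZero Mc] (y : Tor (fun _ : Fin d => Mc)) :
    liftT (up n (fun _ : Fin d => Mc) y) = (n : ℤ) • liftT y := by
  funext ν
  simp only [liftT, Pi.smul_apply, smul_eq_mul]
  have hup : up n (fun _ : Fin d => Mc) y ν = ((n * (y ν).val : ℕ) : ZMod (fine n (fun _ : Fin d => Mc) ν)) := by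
    show upHom n (fun _ : Fin d => Mc) ν (y ν) = _
    conv_lhs => rw [← ZMod.natCast_zmod_val (y ν), ← Int.cast_natCast, upHom_intCast]
    push_cast; ring
  have hlt : n * (y ν).val < fine n (fun _ : Fin d => Mc) ν := by
    show n * (y ν).val < n * Mc
    exact Nat.mul_lt_mul_of_pos_left (ZMod.val_lt _) (Nat.pos_of_ne_zero (NeZero.ne n))
  rw [hup, ZMod.val_cast_of_lt hlt]
  push_cast; ring

/-! ## §2 The transfer of a rank-one periodic T4 field to a B5 vector field; Bałaban's `Q_k` through the chart -/

/-- **THE TRANSFER**: a `Matrix (Fin 1) (Fin 1) ℂ`-valued bond field on `ℤ^d` read on the B5 torus `Tor (fine n M) × Fin d` by its single entry. [folklore] -/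
def toB5 {N : Fin d → ℕ} (ξ : Site d → Fin d → Matrix (Fin 1) (Fin 1) ℂ) : Tor N × Fin d → ℂ := fun p => ξ (liftT p.1) p.2 0 0

/-- unfolding. [folklore] -/
theorem toB5_apply {N : Fin d → ℕ} (ξ : Site d → Fin d → Matrix (Fin 1) (Fin 1) ℂ) (x : Tor N) (μ : Fin d) : toB5 ξ (x, μ) = ξ (liftT x) μ 0 0 := rfl

/-- **One block line of (1.18) read through the chart**: `lineSum (toB5 ξ) (bpt y j) μ = Σ_{t<n} (ξ (n•liftT y + boxVec n j + t•e_μ) μ)₀₀` for an `(n·M)`-periodic `ξ`.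
[cite: Balaban1984PropagatorsI, (1.18) p.20] -/
theorem lineSum_toB5 (n Mc : ℕ) [NeZero n] [NeZero Mc] {ξ : Site d → Fin d → Matrix (Fin 1) (Fin 1) ℂ}
    (hξ : IsPeriodicDir ξ ((n * Mc : ℕ) : ℤ)) (y : Tor (fun _ : Fin d => Mc)) (j : Fin d → Fin n) (μ : Fin d) :
    lineSum n (fun _ : Fin d => Mc) (toB5 ξ) (bpt n (fun _ : Fin d => Mc) y j) μ
      = ∑ t ∈ Finset.range n, ξ ((n : ℤ) • liftT y + boxVec n j + (t : ℤ) • e μ) μ 0 0 := by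
  unfold B5Block118.lineSum
  rw [← Fin.sum_univ_eq_sum_range (fun t => ξ ((n : ℤ) • liftT y + boxVec n j + (t : ℤ) • e μ) μ 0 0) n]
  refine Finset.sum_congr rfl fun t _ => ?_
  have hper : ∀ (x : Site d) (κ : Fin d), ξ (x + ((n * Mc : ℕ) : ℤ) • e κ) μ 0 0 = ξ x μ 0 0 := fun x κ => by rw [hξ x κ μ]
  have h1 := read_liftT_add (n * Mc) (f := fun w => ξ w μ 0 0) hper (bpt n (fun _ : Fin d => Mc) y j) (tstep (fine n fun _ : Fin d => Mc) μ ↑t)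
  obtain ⟨k, hk⟩ := liftT_add (n * Mc) (up n (fun _ : Fin d => Mc) y) (iota n (fun _ : Fin d => Mc) j)
  rw [toB5_apply, h1, show bpt n (fun _ : Fin d => Mc) y j = up n (fun _ => Mc) y + iota n (fun _ => Mc) j from rfl, hk, liftT_up, liftT_iota,
    show tstep (fine n fun _ : Fin d => Mc) μ ↑t = tstep (fun _ : Fin d => n * Mc) μ ↑t from rfl,
    liftT_tstep (n * Mc) μ ((t.isLt).trans_le (Nat.le_mul_of_pos_right n (Nat.pos_of_ne_zero (NeZero.ne Mc)))),
    add_right_comm _ (((n * Mc : ℕ) : ℤ) • k) _]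
  exact periodic_smul_vec (f := fun w => ξ w μ 0 0) hper _ k

/-- **BAŁABAN's `Q_k` THROUGH THE CHART IS `η ×` THE T4 STRAIGHT BLOCK LINE MEAN**: for `n = L^j` (`L ≥ 1`), coarse sides `M ≡ N`, and an `(L^j·N)`-periodic rank-one field `ξ`,
`(QvOp n M *ᵥ toB5 ξ) (y, μ) = n⁻¹ · ((Qcoarse L)^[j] ξ (liftT y) μ)₀₀`. [cite: Balaban1984PropagatorsI, (1.18) p.20] -/
theorem QvOp_mulVec_toB5 {L : ℕ} (hL : 1 ≤ L) (j Mc : ℕ) [NeZero Mc] [NeZero (L ^ j)] {ξ : Site d → Fin d → Matrix (Fin 1) (Fin 1) ℂ}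
    (hξ : IsPeriodicDir ξ ((L ^ j * Mc : ℕ) : ℤ)) (y : Tor (fun _ : Fin d => Mc)) (μ : Fin d) :
    (QvOp (L ^ j) (fun _ : Fin d => Mc) *ᵥ toB5 ξ) (y, μ) = ((L ^ j : ℕ) : ℂ)⁻¹ * ((Qcoarse L)^[j] ξ (liftT y) μ) 0 0 := by
  rw [QvOp_mulVec, iterate_Qcoarse_apply hL j ξ (liftT y) μ, Matrix.smul_apply, Matrix.sum_apply]
  simp_rw [lineSum_toB5 (L ^ j) Mc hξ, Matrix.sum_apply]
  rw [sum_univ_boxVec (L ^ j) (fun v => ∑ i ∈ Finset.range (L ^ j), ξ (((L ^ j : ℕ) : ℤ) • liftT y + v + (i : ℤ) • e μ) μ 0 0)]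
  rw [Complex.real_smul]
  push_cast
  have hn : ((L : ℂ) ^ j) ≠ 0 := pow_ne_zero _ (by exact_mod_cast (show L ≠ 0 by omega))
  field_simp
  ring

/-- **THE STRAIGHT SLICE IS `ker Q_k` VERBATIM**: `(Qcoarse L)^[j] ξ = 0 ↔ QvOp (L^j) M *ᵥ toB5 ξ = 0` for an `(L^j·N)`-periodic rank-one field. [folklore] -/
theorem iterate_Qcoarse_eq_zero_iff_QvOp {L : ℕ} (hL : 1 ≤ L) (j Mc : ℕ) [NeZero Mc] [NeZero (L ^ j)] {ξ : Site d → Fin d → Matrix (Fin 1) (Fin 1) ℂ}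
    (hξ : IsPeriodicDir ξ ((L ^ j * Mc : ℕ) : ℤ)) :
    (Qcoarse L)^[j] ξ = 0 ↔ QvOp (L ^ j) (fun _ : Fin d => Mc) *ᵥ toB5 ξ = 0 := by
  have hn : ((L ^ j : ℕ) : ℂ) ≠ 0 := by exact_mod_cast NeZero.ne (L ^ j)
  constructor
  · intro h
    funext p
    obtain ⟨y, μ⟩ := p
    rw [QvOp_mulVec_toB5 hL j Mc hξ, h]
    simp
  · intro h
    -- the coarse field is `Mc`-periodic; every coarse site is a lift up to the period lattice
    have hper : ∀ (z : Site d) (τ κ : Fin d), (Qcoarse L)^[j] ξ (z + (Mc : ℤ) • e τ) κ = (Qcoarse L)^[j] ξ z κ :=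
      NE3TangentFlatStructure.iterate_Qcoarse_add_period L j ξ (P := (Mc : ℤ)) (fun y' τ' μ' => by
        rw [show ((L : ℤ) ^ j * (Mc : ℤ)) = ((L ^ j * Mc : ℕ) : ℤ) by push_cast; ring]; exact hξ y' τ' μ')
    funext z κ
    ext a b
    have ha : a = 0 := Subsingleton.elim _ _
    have hb : b = 0 := Subsingleton.elim _ _
    subst ha; subst hb
    -- reduce `z` to its torus representative
    set y : Tor (fun _ : Fin d => Mc) := fun ν => (z ν : ZMod Mc) with hy
    have hz : ∃ k : Site d, z = liftT y + (Mc : ℤ) • k := by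
      refine ⟨fun ν => z ν / (Mc : ℤ), funext fun ν => ?_⟩
      simp only [liftT, hy, Pi.add_apply, Pi.smul_apply, smul_eq_mul, ZMod.val_intCast]
      linarith [Int.emod_def (z ν) (Mc : ℤ)]
    obtain ⟨k, hk⟩ := hz
    have hread : (Qcoarse L)^[j] ξ z κ = (Qcoarse L)^[j] ξ (liftT y) κ := by
      rw [hk]; exact periodic_smul_vec (f := fun w => (Qcoarse L)^[j] ξ w κ) (fun x τ => hper x τ κ) _ k
    have hq := congr_fun h (y, κ)
    rw [QvOp_mulVec_toB5 hL j Mc hξ, Pi.zero_apply, mul_eq_zero] at hq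
    rw [hread, Pi.zero_apply, Pi.zero_apply, Matrix.zero_apply]
    exact hq.resolve_left (inv_ne_zero hn)

end

end Summit.QuantumFields.BalabanUV.T4Continuum.NE7StraightSliceB5Chart
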